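import Summits.Schanuel.Schanuel.Theorems.EPiSimultaneousType.Negative.OfKhovanskiiApproxType

/-!
# `EPiSimultaneousTypeEv` is the `s = (1, iπ)` instance of the eventual crux `KhovanskiiApproxTypeEv`
(dependency and shape lemmas for item `stmt-Schanuel-14975`, route DiophantineDichotomy)

The route files `EPiSimultaneousTypeEv` (item 14975: the EVENTUAL-in-the-height simultaneous
approximation measure for the pair `(π, e)`, degree exponent `a < 1`, threshold `H ≥ H₀(d)`) as the
flagship instance `n = 2`, `s = (1, iπ)` of the eventual crux `KhovanskiiApproxTypeEv` (item 14972)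
and as the eventual form of `EPiSimultaneousType` (item 6118). This file kernel-checks those three
dependencies, reusing the level/constant bookkeeping of
`Theorems/EPiSimultaneousType/Negative/{LiftClause, OfKhovanskiiApproxType}.lean`:

* `epiSimultaneousTypeEv_of_epiSimultaneousType` — all heights ⇒ eventual (`H₀ := 0`).
* `epiSimultaneousTypeEv_of_measureEvAt_one_I_pi` — LIFT: the eventual measure of the crux's shape at
  `θ = (1, iπ, e, −1)` gives the item: a challenger `(γ₁, γ₂)` of `(π, e)` admissible at level
  `(d, H)` lifts to the challenger `(1, iγ₁, γ₂, −1)` of `θ` admissible at level `(2d, (2d+1)H²)`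
  with the same sup-distance; the pair's threshold at level `d` is the given threshold at level `2d`
  (as `H ≤ (2d+1)H²`), and the witness `(a, b, C)` becomes `(a, max(a+1, b), C(2^{|a|+1} + 2^{|b|}))`.
* `epiSimultaneousTypeEv_of_khovanskiiApproxTypeEv` — the crux at `s = (1, iπ)` (a free Khovanskii
  point: `linearIndependent_one_I_pi`, `khovanskiiSystem_one_I_pi`) gives the item.
* `khovanskiiApproxTypeEv_false_of_not_epiSimultaneousTypeEv` — the route's kill switch (K2):
  a refutation of the `(π, e)` item refutes the load-bearing crux.
* `measureEvAt_one_I_pi_of_epiSimultaneousTypeEv` — converse: the item gives the eventual measure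
  of the crux's shape AT `s = (1, iπ)` (descent `(γ₁, γ₂, γ₃, γ₄) ↦ (−iγ₂, γ₃)`), so item 14975 is
  EXACTLY the `(1, iπ)`-instance of the conclusion of item 14972
  (`epiSimultaneousTypeEv_iff_measureEvAt_one_I_pi`).
* `epiSimultaneousTypeEv_iff_powShape` — the shape of the item: in the eventual currency the `dᵇ`
  term is idle; the item is equivalent to `‖γ − (π, e)‖ ≥ H^{−C dᵃ}` (some `a < 1`, `C > 0`) for all
  admissible `γ` at level `(d, H)`, `H ≥ H₀(d)`.

Everything is proved; no named facts.
-/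

set_option linter.dupNamespace false

noncomputable section

namespace Summit.Schanuel.Schanuel.Theorems

open Polynomial Complex
open scoped IntermediateField
open Summit.Schanuel.Schanuel.Theses.DiophantineDichotomy
open EPiSimultaneousType

/-- **All heights ⇒ eventual**: `EPiSimultaneousType` (item 6118) implies `EPiSimultaneousTypeEv`
(item 14975) with the threshold `H₀ := 0`. [folklore] -/
theorem epiSimultaneousTypeEv_of_epiSimultaneousType (h : EPiSimultaneousType) :
    EPiSimultaneousTypeEv := by
  obtain ⟨a, b, C, ha, hC, hM⟩ := h
  exact ⟨a, b, C, ha, hC, fun d => ⟨0, fun H γ _ hfin hcl => hM d H γ hfin hcl⟩⟩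

/-- A level `(2d+1)H²` is at least `H`, hence past any threshold `H₀ ≤ H`. [folklore] -/
theorem EPiSimultaneousType.threshold_lift_le {d H H₀ : ℕ} (hH0 : H₀ ≤ H) (hH1 : 1 ≤ H) :
    H₀ ≤ (2 * d + 1) * H ^ 2 := by
  refine hH0.trans ?_
  calc H = 1 * H ^ 1 := by ring
    _ ≤ (2 * d + 1) * H ^ 2 :=
        Nat.mul_le_mul (by omega) (Nat.pow_le_pow_right hH1 (by norm_num))

/-- **LIFT: the eventual measure of the crux's shape at `s = (1, iπ)` gives the eventual `(π, e)`
item.** Transfer: a challenger `(γ₁, γ₂)` of `(π, e)` at level `(d, H)` lifts to the challenger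
`(1, iγ₁, γ₂, −1)` of `θ = (1, iπ, e, −1)` at level `(2d, (2d+1)H²)` with the same sup-distance; the
threshold at level `d` is the given threshold at level `2d` (as `H ≤ (2d+1)H²`); a witness `(a, b, C)`
at `θ` gives `(a, max(a+1, b), C(2^{|a|+1} + 2^{|b|}))` for the pair. [folklore] -/
theorem epiSimultaneousTypeEv_of_measureEvAt_one_I_pi
    (h : ∃ a b C : ℝ, a < 1 ∧ 0 < C ∧ ∀ d : ℕ, ∃ H₀ : ℕ, ∀ (H : ℕ) (γ : Fin 2 ⊕ Fin 2 → ℂ), H₀ ≤ H →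
      Module.finrank ℚ ↥(IntermediateField.adjoin ℚ (Set.range γ)) ≤ d →
      (∀ i, ∃ P : Polynomial ℤ, P ≠ 0 ∧ P.natDegree ≤ d ∧ (∀ k, |P.coeff k| ≤ (H : ℤ)) ∧
        Polynomial.aeval (γ i) P = 0) →
      Real.exp (-(C * ((d : ℝ) ^ a * Real.log H + (d : ℝ) ^ b))) ≤
        ‖γ - Sum.elim ![(1 : ℂ), I * Real.pi] (Complex.exp ∘ ![(1 : ℂ), I * Real.pi])‖) :
    EPiSimultaneousTypeEv := by
  obtain ⟨a, b, C0, ha1, hC, hM⟩ := h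
  refine ⟨a, max (a + 1) b, C0 * (2 ^ (|a| + 1) + 2 ^ |b|), ha1, by positivity, ?_⟩
  intro d
  obtain ⟨H₀, hH₀⟩ := hM (2 * d)
  refine ⟨H₀, ?_⟩
  intro H γ hH0 hfin hcl
  obtain ⟨hd1, hH1⟩ := one_le_of_clause' (hcl 0)
  obtain ⟨hH', h1''⟩ := height_lift_le (d := d) hH1
  have hthr : H₀ ≤ (2 * d + 1) * H ^ 2 := threshold_lift_le hH0 hH1
  -- the lifted challenger
  set γ4 : Fin 2 ⊕ Fin 2 → ℂ := Sum.elim ![(1 : ℂ), I * γ 0] ![γ 1, -1] with hγ4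
  have hfin4 : Module.finrank ℚ ↥(IntermediateField.adjoin ℚ (Set.range γ4)) ≤ 2 * d :=
    (finrank_lift_le γ (fun i => isIntegral_of_clause (hcl i))).trans (Nat.mul_le_mul_left 2 hfin)
  have hcl4 : ∀ i, ∃ P : Polynomial ℤ, P ≠ 0 ∧ P.natDegree ≤ 2 * d ∧
      (∀ k, |P.coeff k| ≤ (((2 * d + 1) * H ^ 2 : ℕ) : ℤ)) ∧ Polynomial.aeval (γ4 i) P = 0 := by
    rintro (i | i) <;> fin_cases i
    · refine ⟨X - C 1, X_sub_C_ne_zero 1, by rw [natDegree_X_sub_C]; omega, fun k => ?_,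
        by simp [hγ4]⟩
      rw [coeff_sub, coeff_X, coeff_C]
      rcases k with _ | _ | k
      · simpa using h1''
      · simpa using h1''
      · simp
    · simpa [hγ4] using clause_I_mul (hcl 0)
    · obtain ⟨P, hP0, hdeg, hHt, hroot⟩ := hcl 1
      exact ⟨P, hP0, by omega, fun k => (hHt k).trans hH', by simpa [hγ4] using hroot⟩
    · refine ⟨X + C 1, X_add_C_ne_zero 1, by rw [natDegree_X_add_C]; omega, fun k => ?_,
        by simp [hγ4]⟩
      rw [coeff_add, coeff_X, coeff_C]
      rcases k with _ | _ | k
      · simpa using h1''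
      · simpa using h1''
      · simp
  have hmeas := hH₀ ((2 * d + 1) * H ^ 2) γ4 hthr hfin4 hcl4
  have hdist : ‖γ4 - Sum.elim ![(1 : ℂ), I * Real.pi] (Complex.exp ∘ ![(1 : ℂ), I * Real.pi])‖ ≤
      ‖γ - ![(Real.pi : ℂ), (Real.exp 1 : ℂ)]‖ := by
    rw [pi_norm_le_iff_of_nonneg (norm_nonneg _)]
    rintro (i | i) <;> fin_cases i
    · simp [hγ4]
    · have := norm_le_pi_norm (γ - ![(Real.pi : ℂ), (Real.exp 1 : ℂ)]) 0
      simpa [hγ4, ← mul_sub, norm_mul] using this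
    · have := norm_le_pi_norm (γ - ![(Real.pi : ℂ), (Real.exp 1 : ℂ)]) 1
      simpa [hγ4, Complex.ofReal_exp] using this
    · simp [hγ4]
      rw [mul_comm, Complex.exp_pi_mul_I]; simp
  refine le_trans ?_ (hmeas.trans hdist)
  rw [Real.exp_le_exp, neg_le_neg_iff]
  exact transfer_constants hC.le hd1 hH1

/-- **The eventual crux implies the eventual `(π, e)` item**: `KhovanskiiApproxTypeEv` (item 14972)
at the free Khovanskii point `s = (1, iπ)` (`linearIndependent_one_I_pi`, `khovanskiiSystem_one_I_pi`;
there `a < 1/(2−1) = 1`) gives `EPiSimultaneousTypeEv` (item 14975) by the lift above. [folklore] -/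
theorem epiSimultaneousTypeEv_of_khovanskiiApproxTypeEv (hK : KhovanskiiApproxTypeEv) :
    EPiSimultaneousTypeEv := by
  obtain ⟨a, b, C0, ha, hC, hM⟩ :=
    hK 2 ![(1 : ℂ), I * Real.pi] le_rfl linearIndependent_one_I_pi khovanskiiSystem_one_I_pi
  have ha1 : a < 1 := by norm_num at ha; exact ha
  exact epiSimultaneousTypeEv_of_measureEvAt_one_I_pi ⟨a, b, C0, ha1, hC, hM⟩

/-- **Kill switch (K2) of route DiophantineDichotomy, kernel-checked**: a refutation of the
`(π, e)` item `EPiSimultaneousTypeEv` refutes the load-bearing eventual crux `KhovanskiiApproxTypeEv`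
(as filed, for all `n ≥ 2`). [folklore] -/
theorem khovanskiiApproxTypeEv_false_of_not_epiSimultaneousTypeEv (hne : ¬ EPiSimultaneousTypeEv) :
    ¬ KhovanskiiApproxTypeEv :=
  fun hK => hne (epiSimultaneousTypeEv_of_khovanskiiApproxTypeEv hK)

/-- **Converse: `EPiSimultaneousTypeEv` is exactly the `s = (1, iπ)` instance of the eventual
crux** — the item implies the eventual measure of `KhovanskiiApproxTypeEv`'s shape at
`θ = (1, iπ, e, −1)` (descent of challengers `(γ₁, γ₂, γ₃, γ₄) ↦ (−iγ₂, γ₃)` at level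
`(2d, (2d+1)H²)`, threshold of level `2d`, same constants as above). [folklore] -/
theorem measureEvAt_one_I_pi_of_epiSimultaneousTypeEv (h : EPiSimultaneousTypeEv) :
    ∃ a b C : ℝ, a < 1 ∧ 0 < C ∧ ∀ d : ℕ, ∃ H₀ : ℕ, ∀ (H : ℕ) (γ : Fin 2 ⊕ Fin 2 → ℂ), H₀ ≤ H →
      Module.finrank ℚ ↥(IntermediateField.adjoin ℚ (Set.range γ)) ≤ d →
      (∀ i, ∃ P : Polynomial ℤ, P ≠ 0 ∧ P.natDegree ≤ d ∧ (∀ k, |P.coeff k| ≤ (H : ℤ)) ∧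
        Polynomial.aeval (γ i) P = 0) →
      Real.exp (-(C * ((d : ℝ) ^ a * Real.log H + (d : ℝ) ^ b))) ≤
        ‖γ - Sum.elim ![(1 : ℂ), I * Real.pi] (Complex.exp ∘ ![(1 : ℂ), I * Real.pi])‖ := by
  obtain ⟨a, b, C0, ha, hC, hM⟩ := h
  refine ⟨a, max (a + 1) b, C0 * (2 ^ (|a| + 1) + 2 ^ |b|), ha, by positivity, ?_⟩
  intro d
  obtain ⟨H₀, hH₀⟩ := hM (2 * d)
  refine ⟨H₀, ?_⟩
  intro H γ hH0 hfin hcl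
  obtain ⟨hd1, hH1⟩ := one_le_of_clause' (hcl (Sum.inl 0))
  obtain ⟨hH', -⟩ := height_lift_le (d := d) hH1
  have hthr : H₀ ≤ (2 * d + 1) * H ^ 2 := threshold_lift_le hH0 hH1
  -- the descended challenger
  set p : Fin 2 → ℂ := ![-I * γ (Sum.inl 1), γ (Sum.inr 0)] with hp
  have hfinp : Module.finrank ℚ ↥(IntermediateField.adjoin ℚ (Set.range p)) ≤ 2 * d :=
    (finrank_descent_le γ (fun i => isIntegral_of_clause (hcl i))).trans (Nat.mul_le_mul_left 2 hfin)
  have hclp : ∀ i, ∃ P : Polynomial ℤ, P ≠ 0 ∧ P.natDegree ≤ 2 * d ∧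
      (∀ k, |P.coeff k| ≤ (((2 * d + 1) * H ^ 2 : ℕ) : ℤ)) ∧ Polynomial.aeval (p i) P = 0 := by
    intro i
    fin_cases i
    · have := clause_I_mul (clause_neg (hcl (Sum.inl 1)))
      simpa [hp] using this
    · obtain ⟨P, hP0, hdeg, hHt, hroot⟩ := hcl (Sum.inr 0)
      exact ⟨P, hP0, by omega, fun k => (hHt k).trans hH', by simpa [hp] using hroot⟩
  have hmeas := hH₀ ((2 * d + 1) * H ^ 2) p hthr hfinp hclp
  have hdist : ‖p - ![(Real.pi : ℂ), (Real.exp 1 : ℂ)]‖ ≤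
      ‖γ - Sum.elim ![(1 : ℂ), I * Real.pi] (Complex.exp ∘ ![(1 : ℂ), I * Real.pi])‖ := by
    rw [pi_norm_le_iff_of_nonneg (norm_nonneg _)]
    intro i
    fin_cases i
    · show ‖(p - ![(Real.pi : ℂ), (Real.exp 1 : ℂ)]) 0‖ ≤ _
      have := norm_le_pi_norm
        (γ - Sum.elim ![(1 : ℂ), I * Real.pi] (Complex.exp ∘ ![(1 : ℂ), I * Real.pi])) (Sum.inl 1)
      have e : (p - ![(Real.pi : ℂ), (Real.exp 1 : ℂ)]) 0 = -I * ((γ - Sum.elim ![(1 : ℂ), I * Real.pi]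
          (Complex.exp ∘ ![(1 : ℂ), I * Real.pi])) (Sum.inl 1)) := by
        simp only [hp, Pi.sub_apply, Sum.elim_inl, Matrix.cons_val_zero, Matrix.cons_val_one,
          Matrix.cons_val_fin_one]
        ring_nf
        rw [Complex.I_sq]
        ring
      rw [e, norm_mul]
      simpa using this
    · have := norm_le_pi_norm
        (γ - Sum.elim ![(1 : ℂ), I * Real.pi] (Complex.exp ∘ ![(1 : ℂ), I * Real.pi])) (Sum.inr 0)
      simpa [hp, Complex.ofReal_exp] using this
  refine le_trans ?_ (hmeas.trans hdist)
  rw [Real.exp_le_exp, neg_le_neg_iff]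
  exact transfer_constants hC.le hd1 hH1

/-- **Item 14975 is exactly the `(1, iπ)`-instance of the conclusion of the eventual crux 14972**
(lift + descent above). [folklore] -/
theorem epiSimultaneousTypeEv_iff_measureEvAt_one_I_pi :
    EPiSimultaneousTypeEv ↔
    ∃ a b C : ℝ, a < 1 ∧ 0 < C ∧ ∀ d : ℕ, ∃ H₀ : ℕ, ∀ (H : ℕ) (γ : Fin 2 ⊕ Fin 2 → ℂ), H₀ ≤ H →
      Module.finrank ℚ ↥(IntermediateField.adjoin ℚ (Set.range γ)) ≤ d →
      (∀ i, ∃ P : Polynomial ℤ, P ≠ 0 ∧ P.natDegree ≤ d ∧ (∀ k, |P.coeff k| ≤ (H : ℤ)) ∧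
        Polynomial.aeval (γ i) P = 0) →
      Real.exp (-(C * ((d : ℝ) ^ a * Real.log H + (d : ℝ) ^ b))) ≤
        ‖γ - Sum.elim ![(1 : ℂ), I * Real.pi] (Complex.exp ∘ ![(1 : ℂ), I * Real.pi])‖ :=
  ⟨measureEvAt_one_I_pi_of_epiSimultaneousTypeEv, epiSimultaneousTypeEv_of_measureEvAt_one_I_pi⟩

/-! ### The shape of the item: in the eventual currency the `dᵇ` term is idle -/

/-- **Power shape of the eventual item.** `EPiSimultaneousTypeEv` is equivalent to the `b`-free
statement `∃ a < 1, C > 0, ∀ d ∃ H₀ ∀ H ≥ H₀: ‖γ − (π, e)‖ ≥ H^{−C dᵃ}` for all admissible `γ` at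
level `(d, H)`: past the threshold `log H ≥ d^{b−a}` the constant `exp(−C dᵇ)` is absorbed by
doubling `C` (`→`), and `b := 0` recovers the filed shape (`←`). So in the EVENTUAL form the item
says exactly: the simultaneous approximation exponent of `(π, e)` under the common-field clause is
`O(dᵃ)` for some `a < 1`. [folklore] -/
theorem epiSimultaneousTypeEv_iff_powShape :
    EPiSimultaneousTypeEv ↔
    ∃ a C : ℝ, a < 1 ∧ 0 < C ∧ ∀ d : ℕ, ∃ H₀ : ℕ, ∀ (H : ℕ) (γ : Fin 2 → ℂ), H₀ ≤ H →
      Module.finrank ℚ ↥(IntermediateField.adjoin ℚ (Set.range γ)) ≤ d →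
      (∀ i, ∃ P : Polynomial ℤ, P ≠ 0 ∧ P.natDegree ≤ d ∧ (∀ k, |P.coeff k| ≤ (H : ℤ)) ∧
        Polynomial.aeval (γ i) P = 0) →
      (H : ℝ) ^ (-(C * (d : ℝ) ^ a)) ≤ ‖γ - ![(Real.pi : ℂ), (Real.exp 1 : ℂ)]‖ := by
  constructor
  · rintro ⟨a, b, C, ha, hC, hM⟩
    refine ⟨a, 2 * C, ha, by positivity, fun d => ?_⟩
    obtain ⟨H₀, hH₀⟩ := hM d
    refine ⟨max H₀ (⌈Real.exp ((d : ℝ) ^ (b - a))⌉₊ + 1), fun H γ hH hfin hcl => ?_⟩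
    obtain ⟨hd1, hH1⟩ := one_le_of_clause' (hcl 0)
    have hH0 : H₀ ≤ H := (le_max_left _ _).trans hH
    refine le_trans ?_ (hH₀ H γ hH0 hfin hcl)
    have hHpos : (0 : ℝ) < H := by exact_mod_cast hH1
    have hd0 : (0 : ℝ) < d := by exact_mod_cast hd1
    have hlog : (d : ℝ) ^ (b - a) ≤ Real.log H := by
      have h1 : Real.exp ((d : ℝ) ^ (b - a)) ≤ ⌈Real.exp ((d : ℝ) ^ (b - a))⌉₊ := Nat.le_ceil _
      have h2 : ((⌈Real.exp ((d : ℝ) ^ (b - a))⌉₊ + 1 : ℕ) : ℝ) ≤ H := by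
        exact_mod_cast (le_max_right _ _).trans hH
      push_cast at h2
      rw [← Real.exp_le_exp, Real.exp_log hHpos]
      linarith
    have hda : 0 < (d : ℝ) ^ a := Real.rpow_pos_of_pos hd0 a
    have hdb : (d : ℝ) ^ b = (d : ℝ) ^ a * (d : ℝ) ^ (b - a) := by
      rw [← Real.rpow_add hd0]; congr 1; ring
    rw [Real.rpow_def_of_pos hHpos, Real.exp_le_exp, hdb]
    have key : (d : ℝ) ^ a * (d : ℝ) ^ (b - a) ≤ (d : ℝ) ^ a * Real.log H :=
      mul_le_mul_of_nonneg_left hlog hda.le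
    nlinarith [mul_le_mul_of_nonneg_left key hC.le]
  · rintro ⟨a, C, ha, hC, hM⟩
    refine ⟨a, 0, C, ha, hC, fun d => ?_⟩
    obtain ⟨H₀, hH₀⟩ := hM d
    refine ⟨H₀, fun H γ hH hfin hcl => ?_⟩
    obtain ⟨-, hH1⟩ := one_le_of_clause' (hcl 0)
    have hHpos : (0 : ℝ) < H := by exact_mod_cast hH1
    refine le_trans ?_ (hH₀ H γ hH hfin hcl)
    rw [Real.rpow_def_of_pos hHpos, Real.exp_le_exp, Real.rpow_zero]
    nlinarith [hC]

end Summit.Schanuel.Schanuel.Theorems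

end
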